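import Summits.HodgeConjecture.HodgeConjecture.Theorems.InvariantClassesAreHodge.Negative.InvariantClassesAreHodgeFalseOfQuadricMemberInvariantLine
import Literature.AlgebraicGeometry.HodgeTheory.FermatInvariantClassesAmbient
import Literature.AlgebraicGeometry.HodgeTheory.FermatHypersurfaceReduction
import Literature.AlgebraicGeometry.HodgeTheory.IsoTransport
import Literature.AlgebraicGeometry.Motives.CurveNet
import HarnessLib

/-!
# `InvariantClassesAreHodge` is false as typed: the double-quadric member of `𝔇₀ = (2, 4, {2eᵢ + 2eⱼ})` (refutation)

Crux `stmt-HodgeConjecture-18620` = `Summit.HodgeConjecture.HodgeConjecture.Theses.SparseFermatTropicalDeficiency.InvariantClassesAreHodge`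
(route `SparseFermatTropicalDeficiency`, rank 4). The refuter's negative lemma
`InvariantClassesAreHodge.Negative.InvariantClassesAreHodge_false_of_quadricMemberInvariantLine`
(`Theorems/InvariantClassesAreHodge/Negative/…`, p174104, skeleton vet 2026-08-17) reduced `¬ crux` to the
hypothesis `QuadricMemberInvariantLine`: the degenerate member `c₀ ≡ 2` of the pure datum
`𝔇₀ = (p, d, B₀) = (2, 4, {2eᵢ + 2eⱼ : i < j})`, whose form is `(Σ xᵢ²)²` and whose value of `𝔇₀.variety c₀` is
therefore the REDUCED zero scheme `V₊((Σ xᵢ²)²)_red = V₊(Σ xᵢ²)` — the smooth quadric fourfold `Q ⊂ ℙ⁵` — is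
smooth projective of dimension `4` with `A_{B₀}`-invariant `H⁴` of dimension `≤ 1`, whereas
`invariantRank 𝔇₀ ≥ 2`. This file PROVES that hypothesis (`quadricMemberInvariantLine`) and concludes
`not_InvariantClassesAreHodge : ¬ InvariantClassesAreHodge`:

* §1 `exists_iso_hypersurface_of_zeroLocusClosed_eq` — two forms with the same zero locus have isomorphic
  reduced hypersurfaces `X_{F'} ≅ X_F` compatibly with the embeddings (the tree's `SmoothHypersurface.hypersurface`
  is the reduced induced structure `vanishingIdeal (V₊ F)`, a function of the closed set); such an
  isomorphism intertwines the diagonal symmetries (`iso_hom_comp_diagonalAut`, the embedding is a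
  monomorphism) and hence carries invariant classes to invariant classes (`exists_eq_map_iso_of_invariant`);
  `zeroLocusClosed_pow`: `V₊(Fᵏ) = V₊(F)`.
* §2 `form_cTwo_eq` — `form 𝔇₀ c₀ = Σ xᵢ⁴ + 2 Σ_{i<j} xᵢ² xⱼ² = (Σ xᵢ²)² = (fermatPolynomial 4 2)²`; so
  `X_{c₀} ≅ X⁴₂`, the Fermat quadric fourfold (`exists_iso_variety_cTwo_fermatHypersurface`), which is smooth
  projective of dimension `4` (`isSmoothProjective_fermatHypersurface`); `μ₂⁶ ≤ A_{B₀}`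
  (`fermatGroup_two_le_group`), so the `A_{B₀}`-invariants of `H⁴(X_{c₀}(ℂ); ℂ)` are images of
  `V(0) ⊆ H⁴(X⁴₂(ℂ); ℂ)`, which lies on the line `ℂ h²` (Shioda: the tree's
  `finrank_fermatEigenspace_zero_le_one`, `Literature/…/FermatInvariantClassesAmbient`):
  `finrank_range_proj_cTwo_le_one`.
* §3 `quadricMemberInvariantLine`, `not_InvariantClassesAreHodge`.

CLASS: refuted-MISSTATED. REPAIR `C′` (as in the skeleton vet): add the hypothesis
`SmoothHypersurface.IsNonsingularForm ℂ (𝔇.form c)` (the degree-`d` form itself nonsingular, i.e. `c` in the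
connected smooth locus of the degree-`d` family, which contains the Fermat member) to the crux, to stubs
`stub_invariantRationalBasis` / `stub_invariantOfHodgeType` of line `birth`, and to the `∃ c` of
`TropicalShadowsCarryRank`; the witness misses `C′` because `(Σ xᵢ²)²` is a singular form. Stub
`stub_invariantCupPerfect` is unaffected (landed: `Theorems.invariantCupPerfect`).

Prover seat prover-pub-hodge-ring2-b04-g30-0 (2026-08-21). No definitions, no named facts, no `sorry`;
standard axioms.

## References

* [Shioda1979PJA] T. Shioda, The Hodge conjecture and the Tate conjecture for Fermat varieties, Proc. Japan
  Acad. 55A (1979) 111–114, §4.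
* [Shioda1979HodgeFermat] T. Shioda, The Hodge conjecture for Fermat varieties, Math. Ann. 245 (1979), §1.
* [Hartshorne1977] R. Hartshorne, Algebraic Geometry (1977), I Ex. 5.8, II Example 3.2.6.
* [Katz2009] N. M. Katz, Another look at the Dwork family, Progr. Math. 269 (2009), §3.
-/

set_option linter.dupNamespace false

noncomputable section

open CategoryTheory AlgebraicGeometry MvPolynomial

namespace Summit.HodgeConjecture.HodgeConjecture.Theorems

open Literature.AlgebraicGeometry.Motives Literature.AlgebraicGeometry.HodgeTheory
open Literature.AlgebraicTopology.SingularHomology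
open Summit.HodgeConjecture.HodgeConjecture.Theorems.InvariantClassesAreHodge.Negative

attribute [local instance] MvPolynomial.gradedAlgebra

/-! ### §1 Hypersurfaces with the same zero locus -/

section SameZeroLocus

variable {n : ℕ} {F F' : MvPolynomial (Fin (n + 2)) ℂ}

/-- `V₊(Fᵏ) = V₊(F)` for `k ≠ 0` (relevant homogeneous primes are prime). [folklore] -/
theorem zeroLocusClosed_pow (F : MvPolynomial (Fin (n + 2)) ℂ) {k : ℕ} (hk : k ≠ 0) :
    SmoothHypersurface.zeroLocusClosed (F ^ k) = SmoothHypersurface.zeroLocusClosed F := by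
  refine TopologicalSpace.Closeds.ext (Set.ext fun x ↦ ?_)
  change ({F ^ k} : Set (MvPolynomial (Fin (n + 2)) ℂ)) ⊆ x.asHomogeneousIdeal ↔
    ({F} : Set (MvPolynomial (Fin (n + 2)) ℂ)) ⊆ x.asHomogeneousIdeal
  simp only [Set.singleton_subset_iff, SetLike.mem_coe]
  exact ⟨fun h ↦ x.isPrime.mem_of_pow_mem k h, fun h ↦ Ideal.pow_mem_of_mem _ h k (Nat.pos_of_ne_zero hk)⟩

/-- Equal ideal sheaf data have isomorphic subschemes, compatibly with the inclusions. [folklore] -/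
theorem exists_iso_subscheme_of_eq {X : Scheme} {I J : X.IdealSheafData} (h : I = J) :
    ∃ φ : I.subscheme ≅ J.subscheme, φ.hom ≫ J.subschemeι = I.subschemeι := by
  subst h
  exact ⟨Iso.refl _, Category.id_comp _⟩

/-- **Two forms with the same zero locus define isomorphic (reduced) hypersurfaces**, compatibly with
the embeddings into `ℙⁿ⁺¹`: the reduced induced structure depends on the closed set only.
[cite: Hartshorne1977, II Example 3.2.6] -/
theorem exists_iso_hypersurface_of_zeroLocusClosed_eq
    (h : SmoothHypersurface.zeroLocusClosed F' = SmoothHypersurface.zeroLocusClosed F) :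
    ∃ φ : SmoothHypersurface.hypersurface F' ≅ SmoothHypersurface.hypersurface F,
      φ.hom ≫ SmoothHypersurface.hypersurfaceι F = SmoothHypersurface.hypersurfaceι F' := by
  have hI : SmoothHypersurface.idealSheaf F' = SmoothHypersurface.idealSheaf F := by
    unfold SmoothHypersurface.idealSheaf
    rw [h]
  obtain ⟨φ₀, hφ₀⟩ : ∃ φ₀ : (SmoothHypersurface.hypersurface F').left ≅ (SmoothHypersurface.hypersurface F).left,
      φ₀.hom ≫ (SmoothHypersurface.hypersurfaceι F).left = (SmoothHypersurface.hypersurfaceι F').left :=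
    exists_iso_subscheme_of_eq hI
  refine ⟨Over.isoMk φ₀ ?_, ?_⟩
  · rw [← Over.w (SmoothHypersurface.hypersurfaceι F), ← Over.w (SmoothHypersurface.hypersurfaceι F'),
      ← Category.assoc, hφ₀]
  · ext : 1
    exact hφ₀

/-- **An isomorphism of hypersurfaces compatible with the embeddings intertwines the diagonal
symmetries** `g_a` (both composites with the closed immersion `X_F ↪ ℙⁿ⁺¹` equal `ι' ≫ [z ↦ a • z]`).
[cite: Katz2009, §3] -/
theorem iso_hom_comp_diagonalAut
    (φ : SmoothHypersurface.hypersurface F' ≅ SmoothHypersurface.hypersurface F)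
    (hφ : φ.hom ≫ SmoothHypersurface.hypersurfaceι F = SmoothHypersurface.hypersurfaceι F')
    {a : Fin (n + 2) → ℂˣ} (ha : a ∈ diagonalStabilizer F) (ha' : a ∈ diagonalStabilizer F') :
    φ.hom ≫ diagonalAut F ha = diagonalAut F' ha' ≫ φ.hom := by
  have hφl : φ.hom.left ≫ (SmoothHypersurface.hypersurfaceι F).left =
      (SmoothHypersurface.hypersurfaceι F').left := by
    rw [← Over.comp_left, hφ]
  haveI : Mono (SmoothHypersurface.hypersurfaceι F).left := by
    change Mono (SmoothHypersurface.idealSheaf F).subschemeι; infer_instance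
  ext : 1
  rw [Over.comp_left, Over.comp_left, ← cancel_mono (SmoothHypersurface.hypersurfaceι F).left,
    Category.assoc, Category.assoc, diagonalAut_left_comp_ι, ← Category.assoc, hφl,
    diagonalAut_left_comp_ι]

/-- On cohomology: `g_a^* ∘ φ^* = φ^* ∘ g_a^*` for such an isomorphism. [cite: Katz2009, §3] -/
theorem map_diagonalMap_map_iso
    (φ : SmoothHypersurface.hypersurface F' ≅ SmoothHypersurface.hypersurface F)
    (hφ : φ.hom ≫ SmoothHypersurface.hypersurfaceι F = SmoothHypersurface.hypersurfaceι F')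
    {a : Fin (n + 2) → ℂˣ} (ha : a ∈ diagonalStabilizer F) (ha' : a ∈ diagonalStabilizer F') (k : ℕ)
    (c : complexBetti (SmoothHypersurface.hypersurface F) k) :
    singularCohomology.map ℂ ℂ (diagonalMap F' ha') k (complexBetti.map φ.hom k c) =
      complexBetti.map φ.hom k (singularCohomology.map ℂ ℂ (diagonalMap F ha) k c) := by
  change complexBetti.map (diagonalAut F' ha') k (complexBetti.map φ.hom k c) =
    complexBetti.map φ.hom k (complexBetti.map (diagonalAut F ha) k c)
  rw [← ModuleCat.comp_apply, ← ModuleCat.comp_apply, ← complexBetti.map_comp, ← complexBetti.map_comp,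
    iso_hom_comp_diagonalAut φ hφ ha ha']

/-- **Invariant classes correspond under such an isomorphism**: for a group `G` of diagonal symmetries
of both forms, every `G`-invariant class of `Hᵏ(X_{F'}(ℂ); ℂ)` is `φ^*` of a `G`-invariant class of
`Hᵏ(X_F(ℂ); ℂ)`. [cite: Katz2009, §3] -/
theorem exists_eq_map_iso_of_invariant
    (φ : SmoothHypersurface.hypersurface F' ≅ SmoothHypersurface.hypersurface F)
    (hφ : φ.hom ≫ SmoothHypersurface.hypersurfaceι F = SmoothHypersurface.hypersurfaceι F')
    {G : Subgroup (Fin (n + 2) → ℂˣ)} (hG : G ≤ diagonalStabilizer F) (hG' : G ≤ diagonalStabilizer F')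
    (k : ℕ) {c : complexBetti (SmoothHypersurface.hypersurface F') k}
    (hc : ∀ a : G, singularCohomology.map ℂ ℂ (diagonalMap F' (hG' a.2)) k c = c) :
    ∃ c₀ : complexBetti (SmoothHypersurface.hypersurface F) k,
      (∀ a : G, singularCohomology.map ℂ ℂ (diagonalMap F (hG a.2)) k c₀ = c₀) ∧
      complexBetti.map φ.hom k c₀ = c := by
  obtain ⟨c₀, rfl⟩ := (complexBetti.bijective_map_of_iso φ k).2 c
  refine ⟨c₀, fun a ↦ (complexBetti.bijective_map_of_iso φ k).1 ?_, rfl⟩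
  rw [← map_diagonalMap_map_iso φ hφ (hG a.2) (hG' a.2) k c₀]
  exact hc a

end SameZeroLocus

/-! ### §2 The double quadric `(Σ xᵢ²)² = Σ xᵢ⁴ + 2 Σ_{i<j} xᵢ² xⱼ²` -/

section DoubleQuadric

/-- `monomial (2eᵢ + 2eⱼ) 1 = xᵢ² xⱼ²`. [folklore] -/
theorem monomial_pairExp (ij : Fin 6 × Fin 6) :
    monomial (pairExp ij) (1 : ℂ) = X ij.1 ^ 2 * X ij.2 ^ 2 := by
  simp only [pairExp, X_pow_eq_monomial, monomial_mul, one_mul]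

/-- `pairExp` is injective on the pairs `i < j`. [folklore] -/
theorem pairExp_injOn :
    Set.InjOn pairExp ↑((Finset.univ : Finset (Fin 6 × Fin 6)).filter fun ij ↦ ij.1 < ij.2) := by
  rintro ⟨i, j⟩ hij ⟨i', j'⟩ hij' h
  simp only [Finset.coe_filter, Finset.mem_univ, true_and, Set.mem_setOf_eq] at hij hij'
  have key : ∀ k, (pairExp (i, j)) k = (pairExp (i', j')) k := fun k ↦ by rw [h]
  simp only [pairExp, Finsupp.add_apply, Finsupp.single_apply] at key
  -- each of `i, j` is one of `i', j'` and conversely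
  have hi : i = i' ∨ i = j' := by
    by_contra hc
    push Not at hc
    have := key i
    rw [if_pos rfl, if_neg hij.ne', if_neg (Ne.symm hc.1), if_neg (Ne.symm hc.2)] at this
    omega
  have hj : j = i' ∨ j = j' := by
    by_contra hc
    push Not at hc
    have := key j
    rw [if_neg hij.ne, if_pos rfl, if_neg (Ne.symm hc.1), if_neg (Ne.symm hc.2)] at this
    omega
  have hi' : i' = i ∨ i' = j := by
    by_contra hc
    push Not at hc
    have := key i'
    rw [if_neg (Ne.symm hc.1), if_neg (Ne.symm hc.2), if_pos rfl, if_neg hij'.ne'] at this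
    omega
  simp only [Fin.lt_def] at hij hij'
  simp only [Fin.ext_iff] at hi hj hi'
  simp only [Prod.mk.injEq, Fin.ext_iff]
  omega

/-- **The member `c₀ ≡ 2` of the family `𝔇₀` is the double quadric**:
`form 𝔇₀ c₀ = Σ xᵢ⁴ + 2 Σ_{i<j} xᵢ² xⱼ² = (Σ xᵢ²)²`. [folklore] -/
theorem form_cTwo_eq : quadricDatum.form cTwo = fermatPolynomial ℂ (2 * 2) 2 ^ 2 := by
  have h1 : quadricDatum.form cTwo =
      ∑ i : Fin 6, X i ^ 4 + ∑ b : ↥quarticPairs, C (2 : ℂ) * monomial b.1 (1 : ℂ) := rfl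
  have h2 : fermatPolynomial ℂ (2 * 2) 2 = ∑ i : Fin 6, X i ^ 2 := rfl
  -- the perturbation: `Σ_{b ∈ B₀} 2 x^b = Σ_{i<j} 2 xᵢ² xⱼ²`
  have hB : ∑ b : ↥quarticPairs, C (2 : ℂ) * monomial b.1 (1 : ℂ) =
      ∑ ij ∈ (Finset.univ : Finset (Fin 6 × Fin 6)).filter (fun ij ↦ ij.1 < ij.2),
        2 * (X ij.1 ^ 2 * X ij.2 ^ 2) := by
    rw [Finset.sum_coe_sort quarticPairs (fun b ↦ C (2 : ℂ) * monomial b (1 : ℂ)), quarticPairs,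
      Finset.sum_image pairExp_injOn]
    refine Finset.sum_congr rfl fun ij _ ↦ ?_
    rw [monomial_pairExp, map_ofNat]
  rw [h1, h2, hB, Finset.sum_filter, Fintype.sum_prod_type]
  simp [Fin.sum_univ_six]
  ring

/-- `V₊(form 𝔇₀ c₀) = V₊(Σ xᵢ²)`: the double quadric and the quadric have the same zero locus. [folklore] -/
theorem zeroLocusClosed_form_cTwo :
    SmoothHypersurface.zeroLocusClosed (quadricDatum.form cTwo) =
      SmoothHypersurface.zeroLocusClosed (fermatPolynomial ℂ (2 * 2) 2) := by
  rw [form_cTwo_eq]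
  exact zeroLocusClosed_pow _ two_ne_zero

/-- **`X_{c₀} ≅ Q = X⁴₂`, the Fermat quadric fourfold**, compatibly with the embeddings into `ℙ⁵`
(both are the reduced induced structure on `V₊(Σ xᵢ²)`). [cite: Hartshorne1977, II Example 3.2.6] -/
theorem exists_iso_variety_cTwo_fermatHypersurface :
    ∃ φ : quadricDatum.variety cTwo ≅ fermatHypersurface (2 * 2) 2,
      φ.hom ≫ SmoothHypersurface.hypersurfaceι (fermatPolynomial ℂ (2 * 2) 2) =
        SmoothHypersurface.hypersurfaceι (quadricDatum.form cTwo) :=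
  exists_iso_hypersurface_of_zeroLocusClosed_eq zeroLocusClosed_form_cTwo

/-- **The degenerate member `X_{c₀}` is smooth projective of dimension `4`** (it is the smooth quadric).
[cite: Hartshorne1977, I Ex. 5.8 and II Example 3.2.6] -/
theorem isSmoothProjective_variety_cTwo :
    IsSmoothProjective (2 * quadricDatum.p) (quadricDatum.variety cTwo) := by
  obtain ⟨φ, -⟩ := exists_iso_variety_cTwo_fermatHypersurface
  exact (isSmoothProjective_fermatHypersurface (n := 2 * 2) (m := 2) (by omega) (by omega)).of_iso φ.symm

/-- **`μ₂⁶ ≤ A_{B₀}`**: the sign changes `ζ ∈ {±1}⁶` satisfy `ζᵢ⁴ = 1` and `ζ^b = ζᵢ²ζⱼ² = 1` for every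
`b = 2eᵢ + 2eⱼ ∈ B₀`. [cite: Shioda1979PJA, §4] -/
theorem fermatGroup_two_le_group : fermatGroup (2 * 2) 2 ≤ quadricDatum.group := by
  intro a ha
  have ha2 : ∀ i, a i ^ 2 = 1 := mem_fermatGroup_iff.mp ha
  refine Subgroup.mem_inf.mpr ⟨mem_fermatGroup_iff.mpr fun i ↦ ?_, ?_⟩
  · rw [show quadricDatum.d = 2 * 2 from rfl, pow_mul, ha2 i, one_pow]
  · refine Subgroup.mem_iInf.mpr fun b ↦ Subgroup.mem_iInf.mpr fun hb ↦ MonoidHom.mem_ker.mpr ?_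
    obtain ⟨i, j, -, rfl⟩ := exists_of_mem_quarticPairs hb
    rw [SparseFermat.Datum.monomialChar_apply]
    refine Finset.prod_eq_one fun k _ ↦ ?_
    rw [Finsupp.add_apply, pow_add, Finsupp.single_apply, Finsupp.single_apply]
    split_ifs <;> simp [ha2 k]

/-- **The `A_{B₀}`-invariants of `H⁴(X_{c₀}(ℂ); ℂ)` form at most a line**: they are invariant under the
subgroup `μ₂⁶`, hence correspond under `X_{c₀} ≅ X⁴₂` to `μ₂⁶`-invariant classes of the Fermat quadric,
i.e. to `V(0) ⊆ H⁴(X⁴₂(ℂ); ℂ)`, which lies on the line `ℂ h²` (Shioda; the tree's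
`finrank_fermatEigenspace_zero_le_one`). [cite: Shioda1979HodgeFermat, §1 (1.3)–(1.4)] [cite: Shioda1979PJA, §4] -/
theorem finrank_range_proj_cTwo_le_one :
    Module.finrank ℂ ↥(LinearMap.range (quadricDatum.proj cTwo)) ≤ 1 := by
  obtain ⟨φ, hφ⟩ := exists_iso_variety_cTwo_fermatHypersurface
  have hG : fermatGroup (2 * 2) 2 ≤ diagonalStabilizer (fermatPolynomial ℂ (2 * 2) 2) :=
    fermatGroup_le_diagonalStabilizer 2
  have hG' : fermatGroup (2 * 2) 2 ≤ diagonalStabilizer (quadricDatum.form cTwo) :=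
    fermatGroup_two_le_group.trans (quadricDatum.group_le_diagonalStabilizer cTwo)
  -- the invariants are images of `V(0)` of the Fermat quadric
  have hle : LinearMap.range (quadricDatum.proj cTwo) ≤
      (fermatEigenspace 2 (0 : Fin (2 * 2 + 2) → ZMod 2) (2 * 2)).map (complexBetti.map φ.hom (2 * 2)).hom := by
    intro c hc
    rw [SparseFermat.Datum.proj, range_eigenProjector,
      mem_diagonalCharacterEigenspace_iff_diagonalMap (quadricDatum.group_le_diagonalStabilizer cTwo)] at hc
    have hc' : ∀ a : fermatGroup (2 * 2) 2,
        singularCohomology.map ℂ ℂ (diagonalMap (quadricDatum.form cTwo) (hG' a.2)) (2 * 2) c = c := fun a ↦ by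
      have h := hc ⟨a, fermatGroup_two_le_group a.2⟩
      rw [MonoidHom.one_apply, Units.val_one, one_smul] at h
      exact h
    obtain ⟨c₀, hc₀, rfl⟩ := exists_eq_map_iso_of_invariant φ hφ hG hG' (2 * 2) hc'
    refine Submodule.mem_map_of_mem ?_
    rw [mem_fermatEigenspace_iff]
    intro a
    rw [show fermatCharacter 2 (0 : Fin (2 * 2 + 2) → ZMod 2) a = 1 by simp [fermatCharacter_apply],
      Units.val_one, one_smul]
    exact hc₀ a
  haveI := finite_complexBetti (isSmoothProjective_fermatHypersurface (n := 2 * 2) (m := 2) (by omega) (by omega))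
    (2 * 2)
  calc Module.finrank ℂ ↥(LinearMap.range (quadricDatum.proj cTwo))
      ≤ Module.finrank ℂ ↥((fermatEigenspace 2 (0 : Fin (2 * 2 + 2) → ZMod 2) (2 * 2)).map
          (complexBetti.map φ.hom (2 * 2)).hom) := Submodule.finrank_mono hle
    _ ≤ Module.finrank ℂ ↥(fermatEigenspace 2 (0 : Fin (2 * 2 + 2) → ZMod 2) (2 * 2)) :=
        Submodule.finrank_map_le _ _
    _ ≤ 1 := finrank_fermatEigenspace_zero_le_one (m := 2) (by omega) (r := 2) (by omega)

end DoubleQuadric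

/-! ### §3 The refutation -/

/-- **The hypothesis `QuadricMemberInvariantLine` of the negative lemma holds**: the degenerate member
`X_{c₀} = V₊((Σ xᵢ²)²)_red` of `𝔇₀ = (2, 4, {2eᵢ + 2eⱼ})` is smooth projective of dimension `4` and its
`A_{B₀}`-invariant middle cohomology is at most a line. [cite: Shioda1979HodgeFermat, §1 (1.3)–(1.4)]
[cite: Hartshorne1977, II Example 3.2.6] -/
theorem quadricMemberInvariantLine : QuadricMemberInvariantLine :=
  ⟨isSmoothProjective_variety_cTwo, finrank_range_proj_cTwo_le_one⟩

/-- **`InvariantClassesAreHodge` (crux `stmt-HodgeConjecture-18620`) is FALSE as typed** — refuted,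
MISSTATED class: at the pure datum `𝔇₀ = (2, 4, {2eᵢ + 2eⱼ : i < j})` and the member `c₀ ≡ 2` the form is
`(Σ xᵢ²)²`, whose reduced zero scheme (the value of `𝔇₀.variety c₀`) is the smooth quadric fourfold; it
satisfies the hypothesis `IsSmoothProjective 4 (𝔇₀.variety c₀)`, but its `A_{B₀}`-invariant `H⁴` is the
line `ℂ h²` while `invariantRank 𝔇₀ ≥ 2` (`InvariantClassesAreHodge_false_of_quadricMemberInvariantLine`,
refuter skeleton-vet). REPAIR `C′`: add the hypothesis `SmoothHypersurface.IsNonsingularForm ℂ (𝔇.form c)`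
(the degree-`d` form itself nonsingular, i.e. `c` in the smooth locus of the family) to the crux and to
stubs 1–2 of line `birth`; the witness misses `C′` since `(Σ xᵢ²)²` is a singular form.
[cite: Shioda1979PJA, §4] [cite: Shioda1979HodgeFermat, §1 (1.3)–(1.4)] -/
theorem not_InvariantClassesAreHodge :
    ¬ Summit.HodgeConjecture.HodgeConjecture.Theses.SparseFermatTropicalDeficiency.InvariantClassesAreHodge :=
  InvariantClassesAreHodge_false_of_quadricMemberInvariantLine quadricMemberInvariantLine

end Summit.HodgeConjecture.HodgeConjecture.Theorems

end
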